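import Summits.BirchSwinnertonDyer.Rank1Residual.Additive.GordEvenCongruentPartnerBSD
import Summits.BirchSwinnertonDyer.Rank1Residual.Iwasawa.LocalTowerKernelAdditive
import HarnessLib

/-!
# The e346 END-of-ENDs `T-E346-TP`, §C: the partner μ-anchor by CONTROL at `n = 0` (Greenberg,
# LNM 1716, Prop. 3.8) — the Delbourgo-free road for a partner with `#Sel_{p^∞}(E₁/ℚ) = 1` whose
# bad places away from `p` are additive, modulo the level-`0` local tower kernel above `p` (`hp0₁`,
# the output of row T-T3B)
# (cell `b2b-bsdres`, team n1011, seat p07 (gen 9) — row T-E346-TP §C; lead R5-77 ADD 1 'p07's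
# §C unblocked'; consumes p06 GEN 8's T-T3CTL END `Iwasawa.mu_anchor_of_card_selmer_eq_one_of_additive_away`
# (p303787) BY NAME)

HONEST FRAMING (cell `b2b-bsdres`, run/shared/lean/b2b/bsd-rank1-residual/, verbatim in every
file): the goal of the cell is to DELETE the COMBINATION-SHAPED residual classes of the
Birch–Swinnerton-Dyer formula for ALL analytic-rank `≤ 1` elliptic curves over `ℚ` — "full BSD
formula for every rank `≤ 1` curve in class `C`" assembled STRICTLY from published theorems — so
that the rank-`≤ 1` remainder becomes exactly the CONSTRUCTION-SHAPED classes, which are TYPED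
(missing-input `Prop`s), NOT attempted. This is not "finishing BSD". Team n1011 (N10/N11, the
X4♯(G-ord) e346 receivers): research route; labels and marks UNCHANGED; nothing booked; census /
instrument output = EVIDENCE, never a Literature fact. ASSEMBLY theorems only: NO definition, NO
named fact, NO new named-fact debt (`hDelA` STANDING on the RECEIVER side, flag
`Del02-ThmB-ellp-anomalous`; the PARTNER side here is Delbourgo-free). CONDITIONAL exactly as the
consumed files.

## What and why (r2 §II.28.3 (c1) / II.29.4 / II.30.4; p06's skel/T-T3CTL.md)

§A of `GordEvenCongruentPartnerBSD` (`ClassX4Gord.bsdp_rankZero_e346_of_congruentPartner_mu_zero_of_shaAn_unit`)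
left the partner μ-anchor `hμ₁ : ∀ cyclotomic datum D₁ of E₁, D₁.IsTorsion → D₁.mu = 0` OPAQUE; §B
fed it from Delbourgo 2002 (A)+(B) on a literally non-anomalous partner (T3-LIT). For the sixth
receiver of record (499800el1 ↔ 9800bn1 @ 5, partner literal-ANOMALOUS, bad places 2, 7 of 9800bn1
both ADDITIVE) the road is CONTROL at `n = 0`: p06's `Iwasawa.mu_anchor_of_card_selmer_eq_one_of_additive_away
(hp5) (hSel : #Sel_{p^∞}(E₁/ℚ) = 1) (S) (hadd : bad v ∤ p in S additive) (hp0 : ∀ κ, ∀ v ∈ S, v ∋ p →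
𝒦_{v,0}[p^∞] = ⊥) (hgood)` has LITERALLY the shape of `hμ₁`. Hence:

* `ClassX4Gord.bsdp_rankZero_e346_of_controlPartner_of_shaAn_unit` — §A with `hμ₁` ↦ {`hSel₁`, `S₁`,
  `hadd₁`, `hp0₁` (the v ∣ p input = row T-T3B's output, p12 GEN 8 F5), `hgood₁`}; no `hna₁`, no
  partner `hbsd₁`/`hL₁`/`htam₁`.
* `ClassX4Gord.bsdp_rankZero_five_four_of_controlPartner_of_shaAn_unit` — (5;4,4) numerals.

WHAT IS NEW: nothing mathematically — composition. HONEST PRICE per row: `hSel₁` (census: partner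
rank 0, Ш[p] = 1, E₁(ℚ)[p] = 0 — r2's column), `hp0₁` until T-T3B F5 lands (then discharged by its class
corollary), I1 (`hT`), the X4-3 tuple, MANIN, `ord_p #Ш_an = 0`. Closes nothing; census −0.

References: R. Greenberg, LNM 1716 (1999) §3 Prop. 3.8 (pp. 95–96), p. 88 [GreenbergLNM1716];
D. Delbourgo, J. Number Theory 95 (2002) [Delbourgo2002]; D. Delbourgo, Compositio Math. 113 (1998)
[Delbourgo1998]; R. Greenberg, V. Vatsal, Invent. Math. 142 (2000) §2 [GreenbergVatsal2000];
cells/n1011/ROUTE-2.md §II.28.3 (c1), II.30.4; cells/n1011/skel/T-T3CTL.md.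
-/

set_option autoImplicit false

noncomputable section

open scoped Classical MatrixGroups ModularForm NumberField

open CongruenceSubgroup WeierstrassCurve NumberField IsDedekindDomain Field
  Literature.NumberTheory.EllipticCurves
  Literature.NumberTheory.EllipticCurves.ModularForms
  Literature.NumberTheory.EllipticCurves.Rank1Residual
  Literature.NumberTheory.EllipticCurves.Rank1Residual.Typed
  Literature.NumberTheory.EllipticCurves.Delbourgo2002
  Literature.NumberTheory.EllipticCurves.Greenberg1999
  Literature.NumberTheory.EllipticCurves.GreenbergVatsal2000
  Literature.NumberTheory.EllipticCurves.CoatesGreenberg1996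

namespace Summit.BirchSwinnertonDyer.Rank1Residual.Additive

open Summit.BirchSwinnertonDyer.Rank1Residual.X1.CongruenceTransfer

variable {p : ℕ} [hp : Fact p.Prime] {W₁ W : WeierstrassCurve ℚ} [W₁.IsElliptic] [W₁.IsGloballyMinimal]
  [W.IsElliptic] [W.IsGloballyMinimal]

/-! ### §C The partner μ-anchor by control at `n = 0` (T-T3CTL, p06 GEN 8) -/

/-- **T-E346-TP, CONTROL-partner form.** §A with the partner μ-anchor supplied by Greenberg's
Prop. 3.8 control at `n = 0` on the partner (`#Sel_{p^∞}(E₁/ℚ) = 1`, bad places of `E₁` away from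
`p` additive, level-`0` local tower kernel above `p` trivial — binder `hp0₁`, the output of row T-T3B):
Delbourgo-free and anomaly-free on the partner side. Closes nothing by itself; nothing booked.
[cite: GreenbergLNM1716, §3 Prop. 3.8 (pp. 95–96) and p. 88] [cite: Delbourgo2002, Theorem (A), (C) (p. 40)]
[cite: Delbourgo1998, Prop. 4 (p. 144)]
[cite: GreenbergVatsal2000, §2 Prop. (2.8) with Remark (2.9), Cor. (2.3), pp. 26–27 (arXiv:math/9906215)] -/
theorem ClassX4Gord.bsdp_rankZero_e346_of_controlPartner_of_shaAn_unit
    (hC : Delbourgo2002.thmC_charIdeal_dvd_tameBranch)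
    (hDelA : Delbourgo2002.mainTheorem) (hDelM : Delbourgo2002.mainTheorem_potMult)
    (hDel : Delbourgo1998.prop4_rankZero_pow_dvd_constantCoeff)
    (hGZK : rank_eq_analyticRank_of_analyticRank_le_one) (hmod : hasEntireLFunction_rat)
    (hGV : muLambdaAlg_transfer_of_torsionIso_potOrd_of_not_dvd_torsionOrder)
    (hCG : H1_goodModelKernel_trivial.{0})
    -- receiver columns
    (hX : ClassX4Gord W p) (hp5 : 5 ≤ p) (hcm : ¬ W.HasCM) (hr : W.analyticRank = 0)
    (he : semistabilityIndex W p ∈ ({3, 4, 6} : Finset ℕ))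
    (h2e : 2 ∣ semistabilityIndex W p) (hodd : ¬ 2 ∣ (p - 1) / semistabilityIndex W p)
    -- partner columns + link
    (hX₁ : ClassX4Gord W₁ p) (hcm₁ : ¬ W₁.HasCM)
    (h2e₁ : 2 ∣ semistabilityIndex W₁ p) (he2₁ : semistabilityIndex W₁ p ≠ 2)
    (hodd₁ : ¬ 2 ∣ (p - 1) / semistabilityIndex W₁ p)
    (hT : TorsionIso W₁ W p)
    -- partner control data (T-T3CTL): trivial Selmer, additive away from p, level-0 kernel above p
    (hSel₁ : Nat.card (W₁.selmerGroupPInfty p) = 1)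
    (S₁ : Finset (HeightOneSpectrum (𝓞 ℚ)))
    (hadd₁ : ∀ v ∈ S₁, ((p : ℕ) : 𝓞 ℚ) ∉ v.asIdeal → W₁.HasAdditiveReductionAt v)
    (hp0₁ : ∀ (κ : ZpExtension ℚ p), ∀ v ∈ S₁, ((p : ℕ) : 𝓞 ℚ) ∈ v.asIdeal →
      W₁.localTowerKerPrimary κ (v.adicCompletion ℚ) 0 = ⊥)
    (hgood₁ : ∀ v ∉ S₁, ((p : ℕ) : 𝓞 ℚ) ∉ v.asIdeal ∧ W₁.HasGoodReductionAt v)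
    -- census tuple (EVIDENCE tier)
    (h : CensusX43.OrdinaryTwistPartnerAt W p)
    {N : ℕ} [NeZero N] {f : CuspForm (Gamma0 N) 2} (hf : IsNewformOf W f)
    {χ : MulChar (ZMod p) ℚ_[p]}
    (hχ : CensusX43.IsTeichmullerPow χ (CensusX43.ordinaryTeichmullerExponent W p))
    -- period binder, #Ш_an
    {q : ℚ} (hq : W.entireLFunction 1 = (q : ℂ) * (W.realPeriodRat : ℂ))
    {u : ℤ_[p]ˣ} (hu : ((ratPlusSymbol f 0 : ℚ) : ℚ_[p]) = ((u : ℤ_[p]) : ℚ_[p]) * (q : ℚ_[p]))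
    {s : ℚ} (hs : shaAn W = (s : ℂ)) (hv : padicValRat p s = 0) : BSDp W p :=
  hX.bsdp_rankZero_e346_of_congruentPartner_mu_zero_of_shaAn_unit hC hDelA hDelM hDel hGZK hmod hGV hCG
    hp5 hcm hr he h2e hodd hX₁ hcm₁ h2e₁ he2₁ hodd₁ hT h hf hχ
    (Iwasawa.mu_anchor_of_card_selmer_eq_one_of_additive_away hp5 hSel₁ S₁ hadd₁ hp0₁ hgood₁)
    hq hu hs hv

/-- **T-E346-TP at `(5;4,4)`, CONTROL-partner form** — the row of record 499800el1 ↔ 9800bn1 @ 5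
(partner literal-anomalous; bad places `2, 7` of 9800bn1 additive, `9800 = 2³·5²·7²`): numerals.
Closes nothing by itself; nothing booked.
[cite: GreenbergLNM1716, §3 Prop. 3.8 (pp. 95–96) and p. 88] [cite: Delbourgo2002, Theorem (A), (C) (p. 40)]
[cite: Delbourgo1998, Prop. 4 (p. 144)]
[cite: GreenbergVatsal2000, §2 Prop. (2.8) with Remark (2.9), Cor. (2.3), pp. 26–27 (arXiv:math/9906215)] -/
theorem ClassX4Gord.bsdp_rankZero_five_four_of_controlPartner_of_shaAn_unit (hp5 : p = 5)
    (hC : Delbourgo2002.thmC_charIdeal_dvd_tameBranch)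
    (hDelA : Delbourgo2002.mainTheorem) (hDelM : Delbourgo2002.mainTheorem_potMult)
    (hDel : Delbourgo1998.prop4_rankZero_pow_dvd_constantCoeff)
    (hGZK : rank_eq_analyticRank_of_analyticRank_le_one) (hmod : hasEntireLFunction_rat)
    (hGV : muLambdaAlg_transfer_of_torsionIso_potOrd_of_not_dvd_torsionOrder)
    (hCG : H1_goodModelKernel_trivial.{0})
    (hX : ClassX4Gord W p) (hcm : ¬ W.HasCM) (hr : W.analyticRank = 0)
    (he : semistabilityIndex W p = 4)
    (hX₁ : ClassX4Gord W₁ p) (hcm₁ : ¬ W₁.HasCM) (he₁ : semistabilityIndex W₁ p = 4)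
    (hT : TorsionIso W₁ W p)
    (hSel₁ : Nat.card (W₁.selmerGroupPInfty p) = 1)
    (S₁ : Finset (HeightOneSpectrum (𝓞 ℚ)))
    (hadd₁ : ∀ v ∈ S₁, ((p : ℕ) : 𝓞 ℚ) ∉ v.asIdeal → W₁.HasAdditiveReductionAt v)
    (hp0₁ : ∀ (κ : ZpExtension ℚ p), ∀ v ∈ S₁, ((p : ℕ) : 𝓞 ℚ) ∈ v.asIdeal →
      W₁.localTowerKerPrimary κ (v.adicCompletion ℚ) 0 = ⊥)
    (hgood₁ : ∀ v ∉ S₁, ((p : ℕ) : 𝓞 ℚ) ∉ v.asIdeal ∧ W₁.HasGoodReductionAt v)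
    (h : CensusX43.OrdinaryTwistPartnerAt W p)
    {N : ℕ} [NeZero N] {f : CuspForm (Gamma0 N) 2} (hf : IsNewformOf W f)
    {χ : MulChar (ZMod p) ℚ_[p]}
    (hχ : CensusX43.IsTeichmullerPow χ (CensusX43.ordinaryTeichmullerExponent W p))
    {q : ℚ} (hq : W.entireLFunction 1 = (q : ℂ) * (W.realPeriodRat : ℂ))
    {u : ℤ_[p]ˣ} (hu : ((ratPlusSymbol f 0 : ℚ) : ℚ_[p]) = ((u : ℤ_[p]) : ℚ_[p]) * (q : ℚ_[p]))
    {s : ℚ} (hs : shaAn W = (s : ℂ)) (hv : padicValRat p s = 0) : BSDp W p := by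
  subst hp5
  exact hX.bsdp_rankZero_e346_of_controlPartner_of_shaAn_unit hC hDelA hDelM hDel hGZK hmod hGV hCG
    le_rfl hcm hr (by rw [he]; decide) (by rw [he]; decide) (by rw [he]; decide) hX₁ hcm₁
    (by rw [he₁]; decide) (by rw [he₁]; decide) (by rw [he₁]; decide) hT hSel₁ S₁ hadd₁ hp0₁ hgood₁ h hf
    hχ hq hu hs hv

end Summit.BirchSwinnertonDyer.Rank1Residual.Additive

end
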